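import Summits.QuantumFields.YangMills.Theorems.VirialFluxGapCentralDriveTerms
import Summits.QuantumFields.YangMills.Theorems.VirialFluxGapRingPolyInsertion
import HarnessLib

/-!
# Route `VirialFluxGap` (YangMills): THE DRIVE INEQUALITY OF THE EXPLICIT CENTRAL FIELD — clause (P2) of the central package for
# ⟨stmt-QuantumFields-24141⟩ `PeriodicSoftness`, summed over the terms of the ring polynomial (free-hands helper; F3 of the w3 plan)

Width seat `ym-line-sfw-p2-w3` g59 (cell ym-idea-1, free hands), `--supports stmt-QuantumFields-24141`.

★★★ `central_drive_lower` — on the central region of a slice-`0` comb-gauged ring history `P` (signs `σ_k, σ₄ = ±1` with `σ_k·Re q(w_k) ≥ ½`,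
`σ₄·Re q(P.2 0) ≥ ½`; block averages `|z_k|², |z₄|² ≤ min(½, ρ²/2)`), the drive of the explicit central field `Y = centralDir σ σ₄ (ringCoord P)`
satisfies, with `F = F₀(P)`, `K = 384·L²·√F + 3ρ`,
  `frameD Y ringPoly (ringCoord P) ≥ 2F − (9216·L⁴·F·F + K·(3F + 147456·L⁴·F·(3L³ + 6L⁴)))`,
i.e. `drive ≥ 2(1 − ε)F` with the EXPLICIT `ε(L, ρ, F) = ½[9216L⁴F + (384L²√F + 3ρ)(3 + 147456L⁴(3L³ + 6L⁴))]`.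
Proof: `frameD = D(ringPoly)[mulTangent Y M]` is minus the sum of insertions (✓`fderiv_ringPoly_apply`), `ringPoly` is the sum of its terms, and
term by term ✓`temporal_drive_le` ∕ ✓`seam_drive_le` ∕ ✓`plaquette_drive_le` (the Euler-defect inequality ✓`euler_defect_four_le`); the terms are
non-negative and there are `3L³ + 6L⁴` seam∕plaquette terms.  (The window adapter to `X_fix` letters with `√F ≤ √t_C` — the literal (P2) of
✓`periodicSoftness_of_centralDrive` — is the companion step.)

HONEST LABEL: one inequality of the package; nothing closed; ⟨24141⟩ and ⟨22884⟩ stay OPEN; the Yang–Mills mass gap is NOT proved by this; no summit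
is proved by a line.  THEOREMS ONLY (no `def`, no `sorry`).

References: [cite: CosteEtAl1985]; [cite: Luscher1983, §2]; [cite: arXiv220412737, §2 (2.4) (p. 10)].
-/

set_option autoImplicit false

noncomputable section

open scoped Matrix BigOperators Quaternion
open Literature.MathematicalPhysics.QuantumFieldTheory hiding SU2
open Literature.MathematicalPhysics.QuantumLattice

namespace Summit.QuantumFields.YangMills.Theorems.VirialFluxGap.CentralDrive

open Summit.QuantumFields.YangMills.Theorems.FemtoTransferGap
open Summit.QuantumFields.YangMills.Theorems.FemtoTransferGap.TwoLattice.Flat (combFlat combFlat_apply wrapReps)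
open Summit.QuantumFields.YangMills.Theorems.VirialFluxGap.RingDeficit
open Summit.QuantumFields.YangMills.Theorems.VirialFluxGap.FrameDerivative
open Summit.QuantumFields.YangMills.Theorems.VirialFluxGap.FrameHessian
open Summit.QuantumFields.YangMills.Theorems.VirialFluxGap.CentralField
open Summit.QuantumFields.YangMills.Theorems.VirialFluxGap.CentralCoercivity
open Summit.QuantumFields.YangMills.Theorems.VirialFluxGap.CentralSlotReading
open Summit.QuantumFields.YangMills.Theorems.VirialFluxGap.EulerDefect
open Summit.QuantumFields.YangMills.Theorems.ToronValleyVolume.Lojasiewicz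

variable {L : ℕ} [NeZero L]

/-! ## §1 Non-negativity of the terms and the term count -/

/-- `Re x ≤ 1` for a product bounded in norm by `1`. [folklore] -/
theorem re_le_one_of_norm_le {x : ℍ} (hx : ‖x‖ ≤ 1) : x.re ≤ 1 :=
  ((abs_le.mp (abs_re_le_norm x)).2).trans hx

/-- The temporal terms of `ringPoly` are non-negative at a ring history. [folklore] -/
theorem temporal_term_nonneg (P : (Fin (2 * L - 1 + 1) → GaugeConfig 3 L SU2) × (Site 3 L → SU2)) (i : Fin (2 * L - 1)) (e : Edge 3 L) :
    0 ≤ 2 - (((ringCoord L P).1 i.castSucc e * ((ringCoord L P).1 i.succ e)ᴴ).trace).re := by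
  rw [ringCoord_fst_eq, ringCoord_fst_eq, ← Literature.Geometry.GaugeTheory.quatMatrix_star, ← quatMatrix_mul, trace_quatMatrix_re]
  have h := re_le_one_of_norm_le (x := slotQuat P (Sum.inl (i.castSucc, e)) * star (slotQuat P (Sum.inl (i.succ, e))))
    (by rw [norm_mul, norm_star, norm_slotQuat, norm_slotQuat, mul_one])
  linarith

/-- The seam terms of `ringPoly` are non-negative at a ring history. [folklore] -/
theorem seam_term_nonneg (P : (Fin (2 * L - 1 + 1) → GaugeConfig 3 L SU2) × (Site 3 L → SU2)) (e : Edge 3 L) :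
    0 ≤ 2 - (((ringCoord L P).1 (Fin.last (2 * L - 1)) e *
      ((ringCoord L P).2 e.1 * (ringCoord L P).1 0 e * ((ringCoord L P).2 (e.1.shift e.2))ᴴ)ᴴ).trace).re := by
  rw [ringCoord_fst_eq, ringCoord_fst_eq, ringCoord_snd_eq, ringCoord_snd_eq]
  simp only [← Literature.Geometry.GaugeTheory.quatMatrix_star, ← quatMatrix_mul, trace_quatMatrix_re]
  have h := re_le_one_of_norm_le (x := slotQuat P (Sum.inl (Fin.last (2 * L - 1), e)) *
      star (slotQuat P (Sum.inr e.1) * slotQuat P (Sum.inl (0, e)) * star (slotQuat P (Sum.inr (e.1.shift e.2)))))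
    (by rw [norm_mul, norm_star, norm_mul, norm_mul, norm_star, norm_slotQuat, norm_slotQuat, norm_slotQuat, norm_slotQuat]; norm_num)
  linarith

/-- The plaquette terms of `ringPoly` are non-negative at a ring history. [folklore] -/
theorem plaquette_term_nonneg (P : (Fin (2 * L - 1 + 1) → GaugeConfig 3 L SU2) × (Site 3 L → SU2)) (j : Fin (2 * L - 1 + 1))
    (p : Plaquette 3 L) :
    0 ≤ 2 - (((ringCoord L P).1 j (p.1, p.2.1.1) * (ringCoord L P).1 j (p.1.shift p.2.1.1, p.2.1.2) *
      ((ringCoord L P).1 j (p.1.shift p.2.1.2, p.2.1.1))ᴴ * ((ringCoord L P).1 j (p.1, p.2.1.2))ᴴ).trace).re := by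
  rw [ringCoord_fst_eq, ringCoord_fst_eq, ringCoord_fst_eq, ringCoord_fst_eq]
  simp only [← Literature.Geometry.GaugeTheory.quatMatrix_star, ← quatMatrix_mul, trace_quatMatrix_re]
  have h := re_le_one_of_norm_le (x := slotQuat P (Sum.inl (j, (p.1, p.2.1.1))) * slotQuat P (Sum.inl (j, (p.1.shift p.2.1.1, p.2.1.2))) *
      star (slotQuat P (Sum.inl (j, (p.1.shift p.2.1.2, p.2.1.1)))) * star (slotQuat P (Sum.inl (j, (p.1, p.2.1.2)))))
    (by rw [norm_mul, norm_mul, norm_mul, norm_star, norm_star, norm_slotQuat, norm_slotQuat, norm_slotQuat, norm_slotQuat]; norm_num)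
  linarith

/-- The seam and plaquette terms number `3L³ + 2L·3L³ = 3L³ + 6L⁴` (`|Edge| = 3L³`, `|Plaquette| = 3L³`, `2L` slices). [folklore] -/
theorem card_seam_add_plaquette_le :
    (Fintype.card (Edge 3 L) : ℝ) + (Fintype.card (Fin (2 * L - 1 + 1)) : ℝ) * (Fintype.card (Plaquette 3 L) : ℝ)
      ≤ 3 * (L : ℝ) ^ 3 + 6 * (L : ℝ) ^ 4 := by
  have hL : 1 ≤ L := NeZero.one_le
  have hsub : Fintype.card {p : Fin 3 × Fin 3 // p.1 < p.2} = 3 := by decide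
  have h2L : ((2 * L - 1 + 1 : ℕ) : ℝ) = 2 * L := by
    have : 2 * L - 1 + 1 = 2 * L := by omega
    rw [this]; push_cast; ring
  have hE : (Fintype.card (Edge 3 L) : ℝ) = (L : ℝ) ^ 3 * 3 := by
    simp only [Fintype.card_prod, Fintype.card_fun, ZMod.card, Fintype.card_fin]; push_cast; ring
  have hP : (Fintype.card (Plaquette 3 L) : ℝ) = (L : ℝ) ^ 3 * 3 := by
    simp only [Fintype.card_prod, Fintype.card_fun, ZMod.card, Fintype.card_fin, hsub]; push_cast; ring
  rw [hE, hP, Fintype.card_fin, h2L]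
  nlinarith

/-! ## §2 Summation -/

omit [NeZero L] in
/-- Summing per-term bounds `2T_t − a(bT_t + c) ≤ −E_t`. [folklore] -/
theorem sum_drive_bound {ι : Type*} [Fintype ι] (T E : ι → ℝ) (a b c : ℝ) (h : ∀ t, 2 * T t - a * (b * T t + c) ≤ -E t) :
    2 * (∑ t, T t) - a * (b * ∑ t, T t + c * Fintype.card ι) ≤ -∑ t, E t := by
  have hs := Finset.sum_le_sum fun t (_ : t ∈ Finset.univ) => h t
  rw [Finset.sum_neg_distrib] at hs
  have e : ∑ t, (2 * T t - a * (b * T t + c)) = 2 * (∑ t, T t) - a * (b * ∑ t, T t + c * Fintype.card ι) := by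
    rw [Finset.sum_sub_distrib, ← Finset.mul_sum, ← Finset.mul_sum, Finset.sum_add_distrib, ← Finset.mul_sum, Finset.sum_const,
      Finset.card_univ, nsmul_eq_mul]
    ring
  linarith

omit [NeZero L] in
/-- The same for a double sum. [folklore] -/
theorem sum_drive_bound₂ {α β : Type*} [Fintype α] [Fintype β] (T E : α → β → ℝ) (a b c : ℝ)
    (h : ∀ x y, 2 * T x y - a * (b * T x y + c) ≤ -E x y) :
    2 * (∑ x, ∑ y, T x y) - a * (b * ∑ x, ∑ y, T x y + c * (Fintype.card α * Fintype.card β)) ≤ -∑ x, ∑ y, E x y := by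
  have hs := sum_drive_bound (fun xy : α × β => T xy.1 xy.2) (fun xy => E xy.1 xy.2) a b c (fun xy => h xy.1 xy.2)
  simpa only [Fintype.sum_prod_type, Fintype.card_prod, Nat.cast_mul] using hs

/-! ## §3 The drive inequality -/

/-- ★★★ **THE DRIVE INEQUALITY OF THE EXPLICIT CENTRAL FIELD (clause (P2), explicit error).**  On the central region of a slice-`0` comb-gauged
ring history `P` — `σ_k, σ₄ = ±1`, `σ_k·Re q(w_k) ≥ ½`, `σ₄·Re q(P.2 0) ≥ ½`, `|z_k|², |z₄|² ≤ ½` and `2|z_k|², 2|z₄|² ≤ ρ²`, `0 ≤ ρ` — with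
`F = F₀(P)` and `K = 4·(96L²√F) + 3ρ`:
  `2F − (9216·L⁴·F·F + K·(3F + 147456·L⁴·F·(3L³ + 6L⁴))) ≤ frameD (centralDir σ σ₄ (ringCoord P)) ringPoly (ringCoord P)`.
[cite: CosteEtAl1985] -/
theorem central_drive_lower {σ : Fin 3 → ℝ} (hσ : ∀ k, σ k = 1 ∨ σ k = -1) {σ₄ : ℝ} (hσ₄ : σ₄ = 1 ∨ σ₄ = -1)
    (P : (Fin (2 * L - 1 + 1) → GaugeConfig 3 L SU2) × (Site 3 L → SU2)) (ht : treeGauge (P.1 0) = 1)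
    (hW : ∀ k : Fin 3, (1 / 2 : ℝ) ≤ σ k * (su2Quat (wrapReps (P.1 0) k)).re) (hS : (1 / 2 : ℝ) ≤ σ₄ * (su2Quat (P.2 0)).re)
    (hz : ∀ k : Fin 3, (blockIm L (wrapBlock L k) k P 0) ^ 2 + (blockIm L (wrapBlock L k) k P 1) ^ 2 + (blockIm L (wrapBlock L k) k P 2) ^ 2 ≤ 1 / 2)
    (hz₄ : (seamIm L P 0) ^ 2 + (seamIm L P 1) ^ 2 + (seamIm L P 2) ^ 2 ≤ 1 / 2)
    {ρ : ℝ} (hρ : 0 ≤ ρ)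
    (hzρ : ∀ k : Fin 3, 2 * ((blockIm L (wrapBlock L k) k P 0) ^ 2 + (blockIm L (wrapBlock L k) k P 1) ^ 2 + (blockIm L (wrapBlock L k) k P 2) ^ 2) ≤ ρ ^ 2)
    (hz₄ρ : 2 * ((seamIm L P 0) ^ 2 + (seamIm L P 1) ^ 2 + (seamIm L P 2) ^ 2) ≤ ρ ^ 2) :
    2 * ringDeficit L (fun _ => false) P
        - (9216 * (L : ℝ) ^ 4 * ringDeficit L (fun _ => false) P * ringDeficit L (fun _ => false) P
          + (4 * (96 * (L : ℝ) ^ 2 * Real.sqrt (ringDeficit L (fun _ => false) P)) + 3 * ρ) * (3 * ringDeficit L (fun _ => false) P + 147456 * (L : ℝ) ^ 4 * ringDeficit L (fun _ => false) P * (3 * (L : ℝ) ^ 3 + 6 * (L : ℝ) ^ 4)))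
      ≤ frameD (centralDir L σ σ₄ (ringCoord L P)) (ringPoly L) (ringCoord L P) := by
  have hF0 : 0 ≤ ringDeficit L (fun _ => false) P := ringDeficit_nonneg _ P
  have hK0 : 0 ≤ (4 * (96 * (L : ℝ) ^ 2 * Real.sqrt (ringDeficit L (fun _ => false) P)) + 3 * ρ) := by positivity
  -- term-by-term inequalities, summed per family
  have h1 := sum_drive_bound₂ (fun (i : Fin (2 * L - 1)) (e : Edge 3 L) => (2 : ℝ) - (((ringCoord L P).1 i.castSucc e * ((ringCoord L P).1 i.succ e)ᴴ).trace).re)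
    (fun (i : Fin (2 * L - 1)) (e : Edge 3 L) => (((ringCoord L P).1 i.castSucc e * centralDir L σ σ₄ (ringCoord L P) (Sum.inl (i.castSucc, e)) * ((ringCoord L P).1 i.succ e)ᴴ + (ringCoord L P).1 i.castSucc e * ((ringCoord L P).1 i.succ e * centralDir L σ σ₄ (ringCoord L P) (Sum.inl (i.succ, e)))ᴴ).trace).re)
    (9216 * (L : ℝ) ^ 4 * ringDeficit L (fun _ => false) P) 1 0 (fun i e => by
      have h := temporal_drive_le hσ hσ₄ P ht hW hS hz hz₄ i e
      linarith)
  have h2 := sum_drive_bound (fun e : Edge 3 L => (2 : ℝ) - (((ringCoord L P).1 (Fin.last (2 * L - 1)) e * ((ringCoord L P).2 e.1 * (ringCoord L P).1 0 e * ((ringCoord L P).2 (e.1.shift e.2))ᴴ)ᴴ).trace).re)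
    (fun e : Edge 3 L => (((ringCoord L P).1 (Fin.last (2 * L - 1)) e * centralDir L σ σ₄ (ringCoord L P) (Sum.inl ((Fin.last (2 * L - 1)), e)) * ((ringCoord L P).2 e.1 * (ringCoord L P).1 0 e * ((ringCoord L P).2 (e.1.shift e.2))ᴴ)ᴴ + (ringCoord L P).1 (Fin.last (2 * L - 1)) e * ((ringCoord L P).2 e.1 * centralDir L σ σ₄ (ringCoord L P) (Sum.inr e.1) * (ringCoord L P).1 0 e * ((ringCoord L P).2 (e.1.shift e.2))ᴴ + (ringCoord L P).2 e.1 * ((ringCoord L P).1 0 e * centralDir L σ σ₄ (ringCoord L P) (Sum.inl (0, e))) * ((ringCoord L P).2 (e.1.shift e.2))ᴴ + (ringCoord L P).2 e.1 * (ringCoord L P).1 0 e * ((ringCoord L P).2 (e.1.shift e.2) * centralDir L σ σ₄ (ringCoord L P) (Sum.inr (e.1.shift e.2)))ᴴ)ᴴ).trace).re)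
    (4 * (96 * (L : ℝ) ^ 2 * Real.sqrt (ringDeficit L (fun _ => false) P)) + 3 * ρ) 3 (147456 * (L : ℝ) ^ 4 * ringDeficit L (fun _ => false) P) (fun e => seam_drive_le hσ hσ₄ P ht hW hS hz hz₄ hρ hzρ hz₄ρ e)
  have h3 := sum_drive_bound₂ (fun (j : Fin (2 * L - 1 + 1)) (p : Plaquette 3 L) => (2 : ℝ) - (((ringCoord L P).1 j (p.1, p.2.1.1) * (ringCoord L P).1 j (p.1.shift p.2.1.1, p.2.1.2) * ((ringCoord L P).1 j (p.1.shift p.2.1.2, p.2.1.1))ᴴ * ((ringCoord L P).1 j (p.1, p.2.1.2))ᴴ).trace).re)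
    (fun (j : Fin (2 * L - 1 + 1)) (p : Plaquette 3 L) => (((ringCoord L P).1 j (p.1, p.2.1.1) * centralDir L σ σ₄ (ringCoord L P) (Sum.inl (j, (p.1, p.2.1.1))) * (ringCoord L P).1 j (p.1.shift p.2.1.1, p.2.1.2) * ((ringCoord L P).1 j (p.1.shift p.2.1.2, p.2.1.1))ᴴ * ((ringCoord L P).1 j (p.1, p.2.1.2))ᴴ + (ringCoord L P).1 j (p.1, p.2.1.1) * ((ringCoord L P).1 j (p.1.shift p.2.1.1, p.2.1.2) * centralDir L σ σ₄ (ringCoord L P) (Sum.inl (j, (p.1.shift p.2.1.1, p.2.1.2)))) * ((ringCoord L P).1 j (p.1.shift p.2.1.2, p.2.1.1))ᴴ * ((ringCoord L P).1 j (p.1, p.2.1.2))ᴴ + (ringCoord L P).1 j (p.1, p.2.1.1) * (ringCoord L P).1 j (p.1.shift p.2.1.1, p.2.1.2) * ((ringCoord L P).1 j (p.1.shift p.2.1.2, p.2.1.1) * centralDir L σ σ₄ (ringCoord L P) (Sum.inl (j, (p.1.shift p.2.1.2, p.2.1.1))))ᴴ * ((ringCoord L P).1 j (p.1, p.2.1.2))ᴴ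 + (ringCoord L P).1 j (p.1, p.2.1.1) * (ringCoord L P).1 j (p.1.shift p.2.1.1, p.2.1.2) * ((ringCoord L P).1 j (p.1.shift p.2.1.2, p.2.1.1))ᴴ * ((ringCoord L P).1 j (p.1, p.2.1.2) * centralDir L σ σ₄ (ringCoord L P) (Sum.inl (j, (p.1, p.2.1.2))))ᴴ).trace).re)
    (4 * (96 * (L : ℝ) ^ 2 * Real.sqrt (ringDeficit L (fun _ => false) P)) + 3 * ρ) 3 (147456 * (L : ℝ) ^ 4 * ringDeficit L (fun _ => false) P) (fun j p => plaquette_drive_le hσ hσ₄ P ht hW hS hz hz₄ hρ hzρ hz₄ρ j p)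
  -- non-negativity of the partial sums
  have hT1 : 0 ≤ ∑ i : Fin (2 * L - 1), ∑ e : Edge 3 L, ((2 : ℝ) - (((ringCoord L P).1 i.castSucc e * ((ringCoord L P).1 i.succ e)ᴴ).trace).re) :=
    Finset.sum_nonneg fun i _ => Finset.sum_nonneg fun e _ => temporal_term_nonneg P i e
  have hT2 : 0 ≤ ∑ e : Edge 3 L, ((2 : ℝ) - (((ringCoord L P).1 (Fin.last (2 * L - 1)) e * ((ringCoord L P).2 e.1 * (ringCoord L P).1 0 e * ((ringCoord L P).2 (e.1.shift e.2))ᴴ)ᴴ).trace).re) :=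
    Finset.sum_nonneg fun e _ => seam_term_nonneg P e
  have hT3 : 0 ≤ ∑ j : Fin (2 * L - 1 + 1), ∑ p : Plaquette 3 L,
      ((2 : ℝ) - (((ringCoord L P).1 j (p.1, p.2.1.1) * (ringCoord L P).1 j (p.1.shift p.2.1.1, p.2.1.2) * ((ringCoord L P).1 j (p.1.shift p.2.1.2, p.2.1.1))ᴴ *
        ((ringCoord L P).1 j (p.1, p.2.1.2))ᴴ).trace).re) :=
    Finset.sum_nonneg fun j _ => Finset.sum_nonneg fun p _ => plaquette_term_nonneg P j p
  -- the deficit is the sum of the terms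
  have hFsum : ringDeficit L (fun _ => false) P = (∑ i : Fin (2 * L - 1), ∑ e : Edge 3 L, ((2 : ℝ) - (((ringCoord L P).1 i.castSucc e * ((ringCoord L P).1 i.succ e)ᴴ).trace).re)) +
      (∑ e : Edge 3 L, ((2 : ℝ) - (((ringCoord L P).1 (Fin.last (2 * L - 1)) e * ((ringCoord L P).2 e.1 * (ringCoord L P).1 0 e * ((ringCoord L P).2 (e.1.shift e.2))ᴴ)ᴴ).trace).re)) +
      ∑ j : Fin (2 * L - 1 + 1), ∑ p : Plaquette 3 L,
        ((2 : ℝ) - (((ringCoord L P).1 j (p.1, p.2.1.1) * (ringCoord L P).1 j (p.1.shift p.2.1.1, p.2.1.2) * ((ringCoord L P).1 j (p.1.shift p.2.1.2, p.2.1.1))ᴴ *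
          ((ringCoord L P).1 j (p.1, p.2.1.2))ᴴ).trace).re) := by
    rw [ringDeficit_eq_ringPoly]; rfl
  -- the term count
  have hcard := card_seam_add_plaquette_le (L := L)
  have hm := mul_le_mul_of_nonneg_left hcard (mul_nonneg hK0 (by positivity : (0 : ℝ) ≤ 147456 * (L : ℝ) ^ 4 * ringDeficit L (fun _ => false) P))
  have hx1 := mul_nonneg hK0 hT1
  have hx2 := mul_nonneg (by positivity : (0 : ℝ) ≤ 9216 * (L : ℝ) ^ 4 * ringDeficit L (fun _ => false) P) (add_nonneg hT2 hT3)
  -- the drive is minus the sum of the insertions of `H = mulTangent Y M`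
  have hp1 := congrArg (fun t => 9216 * (L : ℝ) ^ 4 * ringDeficit L (fun _ => false) P * t) hFsum
  have hp2 := congrArg (fun t => (4 * (96 * (L : ℝ) ^ 2 * Real.sqrt (ringDeficit L (fun _ => false) P)) + 3 * ρ) * t) hFsum
  simp only at hp1 hp2
  unfold frameD
  rw [fderiv_ringPoly_apply]
  simp only [mulTangent]
  linarith [h1, h2, h3, hm, hx1, hx2, hFsum, hp1, hp2]

end Summit.QuantumFields.YangMills.Theorems.VirialFluxGap.CentralDrive

end
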